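import Summits.QuantumAdvantage.QuantumAdvantage.Theorems.CubicForrelationNearExactIsExactTwelveLevelFiveR1TransversalAt2932
import Summits.QuantumAdvantage.QuantumAdvantage.Theorems.CubicForrelationNearExactIsExactFourFlatLemma

/-!
# Crux `CubicForrelation.NearExactIsExact` (stmt-QuantumAdvantage-14043) — n = 12 AT `Φ = 29/32`, the rigid level-5 configuration R1:
  the `−3`-set `T` is a COSET OF THE RADICAL of the alternating form of `D`, and the radical has exactly `128` elements

Certificate seat `b2b-cforr-cert` (gen 23).  HONEST FRAMING: kernel-checked finite-slice lemmas (standard axioms; two `decide`s on closed Boolean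
identities in `≤ 10` variables) about cubic Boolean pairs on 12 bits; second part of the exclusion of configuration R1 of
`tw22_levelFive_ge2932_rigid`.  NO new value of `θ₁₂`; NOT summit progress.  Paper proof: HOME/b2b-cforr-cert-g23/PROOF-N12-928-L5.md §7 (iv)–(v).

THE ARGUMENT (notation of `…R1TransversalAt2932`: `B` the alternating form of the quadratic `D`, `Pf` its Pfaffian, `R = rad B ∩ V`,
`T = {x ∈ P : e(x) = −3σ(x)}`, `#T = 128`, and a frame `a₀,…,a₃ ∈ V` with `Pf = 1` from `r1_frame`).
1. (`r1_diff_radical`) `T ⊕ T ⊆ R`: if `δ = t ⊕ t'` (`t, t' ∈ T`) had `B(δ,v) = 1` for some period `v`, then some `c', d' ∈ V` have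
   `Pf(δ,v,c',d') = 1` (otherwise `B` restricted to the frame would be the rank-2 form `B(p,q) = B(p,δ)B(q,v) ⊕ B(q,δ)B(p,v)`, whose
   Pfaffian vanishes identically: `r1_pf_rank2`), and the flat `t ⊕ ⟨δ,v,c',d'⟩` would meet `T` in `t` AND `t' = t ⊕ δ` — against the
   transversal property `r1_transversal`.
2. (`r1_R_bound`) `16·#R ≤ #V`: the map `(r, θ) ↦ r ⊕ θ·a` (`r ∈ R`, `θ ∈ 𝔽₂⁴`) is injective, because `θ·a ∈ R` forces `θ·G = 0` for
   the Gram matrix `G` of the frame, which is invertible (`Pf = 1`; `r1_gram_kernel`).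
3. (`r1_structure`) Hence `#R ≤ 128 = #T ≤ #(t₀ ⊕ R)`, so `#R = 128` and `T = t₀ ⊕ R` for any `t₀ ∈ T`.

References: MacWilliams–Sloane (1977) Ch. 15 §2 (symplectic forms); C. Carlet (2020) §5.2.  Axioms: the standard three.
-/

set_option linter.dupNamespace false -- D-0017: single-problem summit ⇒ `QuantumAdvantage.QuantumAdvantage` by design

noncomputable section

namespace Summit.QuantumAdvantage.QuantumAdvantage.Theorems.CubicForrelation.NearExactIsExact

open Finset
open Literature.Computability.QuantumComplexity
open Literature.Computability.QuantumComplexity.BuzetChailloux (bxor zeroVec bxor_bxor_cancel_left bxor_zeroVec zeroVec_bxor bxor_comm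
  bxor_self)
open Literature.Computability.QuantumComplexity.DerivativeWalsh (W)

/-! ### 1. Two closed Boolean identities -/

/-- **The Pfaffian of a rank-2 alternating form vanishes**: for `B(a_j,a_i) = p_i q_j ⊕ p_j q_i` the Pfaffian
`B₁₀B₃₂ ⊕ B₂₀B₃₁ ⊕ B₃₀B₂₁` is `0` (256-case check). [folklore] -/
theorem r1_pf_rank2 (p₀ p₁ p₂ p₃ q₀ q₁ q₂ q₃ : Bool) :
    (((((p₀ && q₁) ^^ (p₁ && q₀)) && ((p₂ && q₃) ^^ (p₃ && q₂))) ^^ (((p₀ && q₂) ^^ (p₂ && q₀)) && ((p₁ && q₃) ^^ (p₃ && q₁))) ^^ (((p₀ && q₃) ^^ (p₃ && q₀)) && ((p₁ && q₂) ^^ (p₂ && q₁))))) = false := by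
  cases p₀ <;> cases p₁ <;> cases p₂ <;> cases p₃ <;> cases q₀ <;> cases q₁ <;> cases q₂ <;> cases q₃ <;> decide

/-- **A `4 × 4` alternating matrix over `𝔽₂` with Pfaffian `1` has trivial kernel** (1024-case check). [folklore] -/
theorem r1_gram_kernel : ∀ (g10 g20 g30 g21 g31 g32 θ0 θ1 θ2 θ3 : Bool),
    (((g10 && g32) ^^ (g20 && g31) ^^ (g30 && g21))) = true →
    ((θ0 && false) ^^ (θ1 && g10) ^^ (θ2 && g20) ^^ (θ3 && g30)) = false →
    ((θ0 && g10) ^^ (θ1 && false) ^^ (θ2 && g21) ^^ (θ3 && g31)) = false →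
    ((θ0 && g20) ^^ (θ1 && g21) ^^ (θ2 && false) ^^ (θ3 && g32)) = false →
    ((θ0 && g30) ^^ (θ1 && g31) ^^ (θ2 && g32) ^^ (θ3 && false)) = false →
    θ0 = false ∧ θ1 = false ∧ θ2 = false ∧ θ3 = false := by
  decide

/-! ### 2. The alternating form on flat points of the origin; the radical is a group -/

/-- `B(0, w) = 0`. [folklore] -/
theorem r1_B_zero_left (D : (Fin (6 + 6) → Bool) → Bool) (w : Fin (6 + 6) → Bool) :
    (D zeroVec ^^ D zeroVec ^^ D w ^^ D (bxor zeroVec w)) = false := by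
  rw [zeroVec_bxor]; cases D zeroVec <;> cases D w <;> rfl

/-- `B(p·a, w) = p ∧ B(a, w)` for a scalar `p ∈ 𝔽₂`. [folklore] -/
theorem r1_B_smul_left (D : (Fin (6 + 6) → Bool) → Bool) (p : Bool) (a w : Fin (6 + 6) → Bool) :
    (D zeroVec ^^ D (fun j => p && a j) ^^ D w ^^ D (bxor (fun j => p && a j) w)) =
      (p && (D zeroVec ^^ D a ^^ D w ^^ D (bxor a w))) := by
  cases p
  · have h : (fun j => false && a j) = (zeroVec : Fin (6 + 6) → Bool) := funext fun j => by simp [zeroVec]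
    rw [h, Bool.false_and]; exact r1_B_zero_left D w
  · have h : (fun j => true && a j) = a := funext fun j => by simp
    rw [h, Bool.true_and]

/-- **`B` at a flat point of the origin**: `B(⊕ θᵢaᵢ, w) = ⊕ θᵢ B(aᵢ, w)` for a quadratic `D` (biadditivity, `es_B_add_left`). [folklore] -/
theorem r1_B_flatPt (D : (Fin (6 + 6) → Bool) → Bool) (hD : IsDegLeFun 2 D) (a₀ a₁ a₂ a₃ : Fin (6 + 6) → Bool)
    (θ : Fin 4 → Bool) (w : Fin (6 + 6) → Bool) :
    (D zeroVec ^^ D (fun j => zeroVec j ^^ decide (Odd #(univ.filter fun i => θ i && (![a₀, a₁, a₂, a₃] : Fin 4 → Fin (6 + 6) → Bool) i j))) ^^ D w ^^ D (bxor (fun j => zeroVec j ^^ decide (Odd #(univ.filter fun i => θ i && (![a₀, a₁, a₂, a₃] : Fin 4 → Fin (6 + 6) → Bool) i j))) w)) =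
      ((θ 0 && (D zeroVec ^^ D a₀ ^^ D w ^^ D (bxor a₀ w))) ^^ (θ 1 && (D zeroVec ^^ D a₁ ^^ D w ^^ D (bxor a₁ w))) ^^
        (θ 2 && (D zeroVec ^^ D a₂ ^^ D w ^^ D (bxor a₂ w))) ^^ (θ 3 && (D zeroVec ^^ D a₃ ^^ D w ^^ D (bxor a₃ w)))) := by
  have ec : (fun j => zeroVec j ^^ decide (Odd #(univ.filter fun i => θ i && (![a₀, a₁, a₂, a₃] : Fin 4 → Fin (6 + 6) → Bool) i j))) =
      bxor (bxor (bxor (bxor zeroVec (fun j => θ 0 && a₀ j)) (fun j => θ 1 && a₁ j)) (fun j => θ 2 && a₂ j))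
        (fun j => θ 3 && a₃ j) := by
    rw [es_flatPt_four zeroVec _ θ]
    have h0 : (![a₀, a₁, a₂, a₃] : Fin 4 → Fin (6 + 6) → Bool) 0 = a₀ := rfl
    have h1 : (![a₀, a₁, a₂, a₃] : Fin 4 → Fin (6 + 6) → Bool) 1 = a₁ := rfl
    have h2 : (![a₀, a₁, a₂, a₃] : Fin 4 → Fin (6 + 6) → Bool) 2 = a₂ := rfl
    have h3 : (![a₀, a₁, a₂, a₃] : Fin 4 → Fin (6 + 6) → Bool) 3 = a₃ := rfl
    simp only [h0, h1, h2, h3]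
    exact es_flatPt_bxor zeroVec a₀ a₁ a₂ a₃ θ
  rw [ec, es_B_add_left D hD, es_B_add_left D hD, es_B_add_left D hD, es_B_add_left D hD, r1_B_zero_left,
    r1_B_smul_left, r1_B_smul_left, r1_B_smul_left, r1_B_smul_left, Bool.false_xor]

/-- The radical `R = {r ∈ V : B(r, V) = 0}` is closed under `⊕`. [folklore] -/
theorem r1_R_add (D : (Fin (6 + 6) → Bool) → Bool) (hD : IsDegLeFun 2 D) (V : Finset (Fin (6 + 6) → Bool))
    (hadd : ∀ a ∈ V, ∀ b ∈ V, bxor a b ∈ V) {r r' : Fin (6 + 6) → Bool}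
    (hr : r ∈ (V.filter fun r => ∀ v ∈ V, (D zeroVec ^^ D r ^^ D v ^^ D (bxor r v)) = false))
    (hr' : r' ∈ (V.filter fun r => ∀ v ∈ V, (D zeroVec ^^ D r ^^ D v ^^ D (bxor r v)) = false)) :
    bxor r r' ∈ (V.filter fun r => ∀ v ∈ V, (D zeroVec ^^ D r ^^ D v ^^ D (bxor r v)) = false) := by
  rw [mem_filter] at hr hr' ⊢
  exact ⟨hadd _ hr.1 _ hr'.1, fun v hv => by rw [es_B_add_left D hD r r' v, hr.2 v hv, hr'.2 v hv]; rfl⟩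

/-! ### 3. `T ⊕ T ⊆ R` -/

/-- **Differences of `T` lie in the radical.**  In configuration R1 with `#T = 128` and a frame with `Pf = 1`: for `t, t' ∈ T` and every
period `v`, `B(t ⊕ t', v) = 0`. [this work] -/
theorem r1_diff_radical (f g : (Fin (6 + 6) → Bool) → Bool) (hf : IsDegLeFun 3 f) (hg : IsDegLeFun 3 g)
    (u' : (Fin (6 + 6) → Bool) → ℤ) (hu' : ∀ x, W (fun y => signOf (g y)) x = (2 : ℝ) ^ 5 * (u' x : ℝ))
    (V : Finset (Fin (6 + 6) → Bool)) (xP x' : Fin (6 + 6) → Bool) (h0 : zeroVec ∈ V) (hadd : ∀ a ∈ V, ∀ b ∈ V, bxor a b ∈ V)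
    (hS : (univ.filter fun x : Fin (6 + 6) → Bool => Odd (u' x)) = V.image (bxor xP))
    (hS' : (univ.filter fun x : Fin (6 + 6) → Bool => ¬ Odd (u' x)) = V.image (bxor x'))
    (hoff : ∀ y, ¬ Odd (u' y) → u' y = 2 * sZ (f y))
    (hPcard : #(univ.filter fun x : Fin (6 + 6) → Bool => Odd (u' x)) = 2048)
    (D : (Fin (6 + 6) → Bool) → Bool) (hD : IsDegLeFun 2 D)
    (hvals : ∀ x, Odd (u' x) → u' x - 2 * sZ (f x) = sZ (D x) ∨ u' x - 2 * sZ (f x) = -3 * sZ (D x))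
    (hT : #(univ.filter fun x : Fin (6 + 6) → Bool => Odd (u' x) ∧ u' x - 2 * sZ (f x) = -3 * sZ (D x)) = 128)
    {a₀ a₁ a₂ a₃ : Fin (6 + 6) → Bool} (ha₀ : a₀ ∈ V) (ha₁ : a₁ ∈ V) (ha₂ : a₂ ∈ V) (ha₃ : a₃ ∈ V)
    (hPf : ((((D zeroVec ^^ D a₁ ^^ D a₀ ^^ D (bxor a₁ a₀)) && (D zeroVec ^^ D a₃ ^^ D a₂ ^^ D (bxor a₃ a₂))) ^^ ((D zeroVec ^^ D a₂ ^^ D a₀ ^^ D (bxor a₂ a₀)) && (D zeroVec ^^ D a₃ ^^ D a₁ ^^ D (bxor a₃ a₁))) ^^ ((D zeroVec ^^ D a₃ ^^ D a₀ ^^ D (bxor a₃ a₀)) && (D zeroVec ^^ D a₂ ^^ D a₁ ^^ D (bxor a₂ a₁))))) = true)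
    (t t' : Fin (6 + 6) → Bool) (ht : Odd (u' t) ∧ u' t - 2 * sZ (f t) = -3 * sZ (D t))
    (ht' : Odd (u' t') ∧ u' t' - 2 * sZ (f t') = -3 * sZ (D t')) :
    bxor t t' ∈ (V.filter fun r => ∀ v ∈ V, (D zeroVec ^^ D r ^^ D v ^^ D (bxor r v)) = false) := by
  classical
  have hmemP : ∀ x, x ∈ V.image (bxor xP) ↔ Odd (u' x) := fun x => by rw [← hS]; simp
  -- `δ = t ⊕ t'` is a period
  have hδV : bxor t t' ∈ V := by
    obtain ⟨w, hw, hwt⟩ := mem_image.1 ((hmemP t).2 ht.1)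
    obtain ⟨w', hw', hwt'⟩ := mem_image.1 ((hmemP t').2 ht'.1)
    have : bxor t t' = bxor w w' := by
      rw [← hwt, ← hwt']; funext j; simp only [bxor]; cases xP j <;> cases w j <;> cases w' j <;> rfl
    rw [this]; exact hadd w hw w' hw'
  rw [mem_filter]
  refine ⟨hδV, fun v hv => ?_⟩
  rcases Bool.eq_false_or_eq_true (D zeroVec ^^ D (bxor t t') ^^ D v ^^ D (bxor (bxor t t') v)) with hB' | hB'
  swap
  · exact hB'
  exfalso
  have hB : (D zeroVec ^^ D v ^^ D (bxor t t') ^^ D (bxor v (bxor t t'))) = true := by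
    rw [← es_B_symm D (bxor t t') v]; exact hB'
  -- some `c', d' ∈ V` complete `(δ, v)` to a quadruple with `Pf = 1`
  have hex : ∃ c' ∈ V, ∃ d' ∈ V,
      ((((D zeroVec ^^ D v ^^ D (bxor t t') ^^ D (bxor v (bxor t t'))) && (D zeroVec ^^ D d' ^^ D c' ^^ D (bxor d' c'))) ^^ ((D zeroVec ^^ D c' ^^ D (bxor t t') ^^ D (bxor c' (bxor t t'))) && (D zeroVec ^^ D d' ^^ D v ^^ D (bxor d' v))) ^^ ((D zeroVec ^^ D d' ^^ D (bxor t t') ^^ D (bxor d' (bxor t t'))) && (D zeroVec ^^ D c' ^^ D v ^^ D (bxor c' v))))) = true := by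
    by_contra hno
    push Not at hno
    have h01 := hno a₀ ha₀ a₁ ha₁
    have h23 := hno a₂ ha₂ a₃ ha₃
    have h02 := hno a₀ ha₀ a₂ ha₂
    have h13 := hno a₁ ha₁ a₃ ha₃
    have h03 := hno a₀ ha₀ a₃ ha₃
    have h12 := hno a₁ ha₁ a₂ ha₂
    rw [hB] at h01 h23 h02 h13 h03 h12
    generalize hp0 : (D zeroVec ^^ D a₀ ^^ D (bxor t t') ^^ D (bxor a₀ (bxor t t'))) = p₀ at h01 h02 h03
    generalize hp1 : (D zeroVec ^^ D a₁ ^^ D (bxor t t') ^^ D (bxor a₁ (bxor t t'))) = p₁ at h01 h12 h13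
    generalize hp2 : (D zeroVec ^^ D a₂ ^^ D (bxor t t') ^^ D (bxor a₂ (bxor t t'))) = p₂ at h23 h02 h12
    generalize hp3 : (D zeroVec ^^ D a₃ ^^ D (bxor t t') ^^ D (bxor a₃ (bxor t t'))) = p₃ at h23 h13 h03
    generalize hq0 : (D zeroVec ^^ D a₀ ^^ D v ^^ D (bxor a₀ v)) = q₀ at h01 h02 h03
    generalize hq1 : (D zeroVec ^^ D a₁ ^^ D v ^^ D (bxor a₁ v)) = q₁ at h01 h12 h13
    generalize hq2 : (D zeroVec ^^ D a₂ ^^ D v ^^ D (bxor a₂ v)) = q₂ at h23 h02 h12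
    generalize hq3 : (D zeroVec ^^ D a₃ ^^ D v ^^ D (bxor a₃ v)) = q₃ at h23 h13 h03
    generalize hg10 : (D zeroVec ^^ D a₁ ^^ D a₀ ^^ D (bxor a₁ a₀)) = g10 at h01 hPf
    generalize hg32 : (D zeroVec ^^ D a₃ ^^ D a₂ ^^ D (bxor a₃ a₂)) = g32 at h23 hPf
    generalize hg20 : (D zeroVec ^^ D a₂ ^^ D a₀ ^^ D (bxor a₂ a₀)) = g20 at h02 hPf
    generalize hg31 : (D zeroVec ^^ D a₃ ^^ D a₁ ^^ D (bxor a₃ a₁)) = g31 at h13 hPf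
    generalize hg30 : (D zeroVec ^^ D a₃ ^^ D a₀ ^^ D (bxor a₃ a₀)) = g30 at h03 hPf
    generalize hg21 : (D zeroVec ^^ D a₂ ^^ D a₁ ^^ D (bxor a₂ a₁)) = g21 at h12 hPf
    have e10 : g10 = ((p₀ && q₁) ^^ (p₁ && q₀)) := by
      revert h01; cases g10 <;> cases p₀ <;> cases q₁ <;> cases p₁ <;> cases q₀ <;> decide
    have e32 : g32 = ((p₂ && q₃) ^^ (p₃ && q₂)) := by
      revert h23; cases g32 <;> cases p₂ <;> cases q₃ <;> cases p₃ <;> cases q₂ <;> decide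
    have e20 : g20 = ((p₀ && q₂) ^^ (p₂ && q₀)) := by
      revert h02; cases g20 <;> cases p₀ <;> cases q₂ <;> cases p₂ <;> cases q₀ <;> decide
    have e31 : g31 = ((p₁ && q₃) ^^ (p₃ && q₁)) := by
      revert h13; cases g31 <;> cases p₁ <;> cases q₃ <;> cases p₃ <;> cases q₁ <;> decide
    have e30 : g30 = ((p₀ && q₃) ^^ (p₃ && q₀)) := by
      revert h03; cases g30 <;> cases p₀ <;> cases q₃ <;> cases p₃ <;> cases q₀ <;> decide
    have e21 : g21 = ((p₁ && q₂) ^^ (p₂ && q₁)) := by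
      revert h12; cases g21 <;> cases p₁ <;> cases q₂ <;> cases p₂ <;> cases q₁ <;> decide
    rw [e10, e32, e20, e31, e30, e21, r1_pf_rank2] at hPf
    exact Bool.false_ne_true hPf
  obtain ⟨c', hc', d', hd', hPf'⟩ := hex
  -- the flat `t ⊕ ⟨δ, v, c', d'⟩` meets `T` once (transversal property) but contains `t` and `t' = t ⊕ δ`
  have hN := r1_transversal f g hf hg u' hu' V xP x' h0 hadd hS hS' hoff hPcard D hD hvals hT hδV hv hc' hd' hPf' t ht.1
  have h2 : 1 < #(univ.filter fun ε : Fin 4 → Bool =>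
      u' (fun j => t j ^^ decide (Odd #(univ.filter fun i => ε i && (![bxor t t', v, c', d'] : Fin 4 → Fin (6 + 6) → Bool) i j))) - 2 * sZ (f (fun j => t j ^^ decide (Odd #(univ.filter fun i => ε i && (![bxor t t', v, c', d'] : Fin 4 → Fin (6 + 6) → Bool) i j)))) = -3 * sZ (D (fun j => t j ^^ decide (Odd #(univ.filter fun i => ε i && (![bxor t t', v, c', d'] : Fin 4 → Fin (6 + 6) → Bool) i j))))) := by
    refine one_lt_card.2 ⟨fun _ => false, ?_, fun l => decide (l = 0), ?_, ?_⟩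
    · rw [mem_filter]
      refine ⟨mem_univ _, ?_⟩
      rw [ffl_flatPt_zero t (![bxor t t', v, c', d'] : Fin 4 → Fin (6 + 6) → Bool)]
      exact ht.2
    · rw [mem_filter]
      refine ⟨mem_univ _, ?_⟩
      rw [ffl_flatPt_single t (![bxor t t', v, c', d'] : Fin 4 → Fin (6 + 6) → Bool) 0]
      have e0 : bxor t ((![bxor t t', v, c', d'] : Fin 4 → Fin (6 + 6) → Bool) 0) = t' := by
        show bxor t (bxor t t') = t'
        rw [bxor_bxor_cancel_left]
      rw [e0]
      exact ht'.2
    · intro h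
      have := congrFun h 0
      simp at this
  omega

/-! ### 4. `16·#R ≤ #V` -/

/-- **The radical has index `≥ 16` in `V`** when a frame with `Pf = 1` exists: `(r, θ) ↦ r ⊕ θ·a` is injective on `R × 𝔽₂⁴`
(`θ·a ∈ R` forces `θ·G = 0` for the invertible Gram matrix `G` of the frame). [this work] -/
theorem r1_R_bound (D : (Fin (6 + 6) → Bool) → Bool) (hD : IsDegLeFun 2 D) (V : Finset (Fin (6 + 6) → Bool)) (h0 : zeroVec ∈ V)
    (hadd : ∀ a ∈ V, ∀ b ∈ V, bxor a b ∈ V)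
    {a₀ a₁ a₂ a₃ : Fin (6 + 6) → Bool} (ha₀ : a₀ ∈ V) (ha₁ : a₁ ∈ V) (ha₂ : a₂ ∈ V) (ha₃ : a₃ ∈ V)
    (hPf : ((((D zeroVec ^^ D a₁ ^^ D a₀ ^^ D (bxor a₁ a₀)) && (D zeroVec ^^ D a₃ ^^ D a₂ ^^ D (bxor a₃ a₂))) ^^ ((D zeroVec ^^ D a₂ ^^ D a₀ ^^ D (bxor a₂ a₀)) && (D zeroVec ^^ D a₃ ^^ D a₁ ^^ D (bxor a₃ a₁))) ^^ ((D zeroVec ^^ D a₃ ^^ D a₀ ^^ D (bxor a₃ a₀)) && (D zeroVec ^^ D a₂ ^^ D a₁ ^^ D (bxor a₂ a₁))))) = true) :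
    16 * #(V.filter fun r => ∀ v ∈ V, (D zeroVec ^^ D r ^^ D v ^^ D (bxor r v)) = false) ≤ #V := by
  classical
  set R := (V.filter fun r => ∀ v ∈ V, (D zeroVec ^^ D r ^^ D v ^^ D (bxor r v)) = false) with hR
  have ha : ∀ i, (![a₀, a₁, a₂, a₃] : Fin 4 → Fin (6 + 6) → Bool) i ∈ V := by
    intro i; fin_cases i <;> assumption
  set c : (Fin 4 → Bool) → (Fin (6 + 6) → Bool) := fun θ => (fun j => zeroVec j ^^ decide (Odd #(univ.filter fun i => θ i && (![a₀, a₁, a₂, a₃] : Fin 4 → Fin (6 + 6) → Bool) i j))) with hc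
  have hcV : ∀ θ : Fin 4 → Bool, c θ ∈ V := fun θ =>
    ws_flatPt_mem V h0 (fun z => z ∈ V) (fun z hz b hb => hadd z hz b hb) 4 zeroVec h0 _ ha θ
  have hRV : ∀ r ∈ R, r ∈ V := fun r hr => (mem_filter.1 hr).1
  -- additivity of `θ ↦ c θ`
  have hcadd : ∀ θ θ' : Fin 4 → Bool, c (bxor θ θ') = bxor (c θ) (c θ') := by
    intro θ θ'
    funext j
    have hip := ffl_ip_bxor θ θ' (fun i => (![a₀, a₁, a₂, a₃] : Fin 4 → Fin (6 + 6) → Bool) i j)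
    simp only [c, bxor]
    rw [hip]
    simp only [zeroVec, Bool.false_xor]
  -- injectivity of `(r, θ) ↦ r ⊕ c θ` on `R × 𝔽₂⁴`
  have hinj : Set.InjOn (fun p : (Fin (6 + 6) → Bool) × (Fin 4 → Bool) => bxor p.1 (c p.2))
      ↑(R ×ˢ (univ : Finset (Fin 4 → Bool))) := by
    rintro ⟨r, θ⟩ hr ⟨r', θ'⟩ hr' heq
    rw [mem_coe, mem_product] at hr hr'
    dsimp only at heq
    have hrr : bxor (c θ) (c θ') = bxor r r' := by
      funext j
      have h := congrFun heq j
      simp only [bxor] at h ⊢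
      revert h
      cases r j <;> cases r' j <;> cases c θ j <;> cases c θ' j <;> decide
    have hmem : c (bxor θ θ') ∈ R := by
      rw [hcadd, hrr]; exact r1_R_add D hD V hadd hr.1 hr'.1
    have hm : ∀ w ∈ V, (D zeroVec ^^ D (c (bxor θ θ')) ^^ D w ^^ D (bxor (c (bxor θ θ')) w)) = false := (mem_filter.1 hmem).2
    have g0 := hm a₀ ha₀
    have g1 := hm a₁ ha₁
    have g2 := hm a₂ ha₂
    have g3 := hm a₃ ha₃
    simp only [c] at g0 g1 g2 g3
    rw [r1_B_flatPt D hD] at g0 g1 g2 g3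
    rw [es_B_self D a₀] at g0
    rw [es_B_symm D a₀ a₁, es_B_self D a₁] at g1
    rw [es_B_symm D a₀ a₂, es_B_symm D a₁ a₂, es_B_self D a₂] at g2
    rw [es_B_symm D a₀ a₃, es_B_symm D a₁ a₃, es_B_symm D a₂ a₃, es_B_self D a₃] at g3
    have hθ := r1_gram_kernel _ _ _ _ _ _ (bxor θ θ' 0) (bxor θ θ' 1) (bxor θ θ' 2) (bxor θ θ' 3) hPf g0 g1 g2 g3
    have hθθ : θ = θ' := by
      funext i
      have hi : bxor θ θ' i = false := by
        fin_cases i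
        exacts [hθ.1, hθ.2.1, hθ.2.2.1, hθ.2.2.2]
      simp only [bxor] at hi
      revert hi; cases θ i <;> cases θ' i <;> decide
    subst hθθ
    have hrr' : r = r' := by
      funext j
      have h := congrFun heq j
      simp only [bxor] at h
      revert h; cases r j <;> cases r' j <;> cases c θ j <;> decide
    rw [hrr']
  have hmaps : ∀ p ∈ R ×ˢ (univ : Finset (Fin 4 → Bool)),
      (fun p : (Fin (6 + 6) → Bool) × (Fin 4 → Bool) => bxor p.1 (c p.2)) p ∈ V := by
    rintro ⟨r, θ⟩ hp
    rw [mem_product] at hp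
    exact hadd r (hRV r hp.1) _ (hcV θ)
  have hle := card_le_card_of_injOn _ hmaps hinj
  rw [card_product, card_univ, Fintype.card_fun, Fintype.card_bool, Fintype.card_fin] at hle
  norm_num at hle
  omega

/-! ### 5. `T = t₀ ⊕ R` and `#R = 128` -/

/-- **Structure of the `−3`-set.**  In configuration R1 with `#T = 128` and a frame with `Pf = 1`: the radical `R` of `B` inside `V`
has exactly `128` elements and `T = t₀ ⊕ R` for every `t₀ ∈ T`. [this work] -/
theorem r1_structure (f g : (Fin (6 + 6) → Bool) → Bool) (hf : IsDegLeFun 3 f) (hg : IsDegLeFun 3 g)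
    (u' : (Fin (6 + 6) → Bool) → ℤ) (hu' : ∀ x, W (fun y => signOf (g y)) x = (2 : ℝ) ^ 5 * (u' x : ℝ))
    (V : Finset (Fin (6 + 6) → Bool)) (xP x' : Fin (6 + 6) → Bool) (h0 : zeroVec ∈ V) (hadd : ∀ a ∈ V, ∀ b ∈ V, bxor a b ∈ V)
    (hS : (univ.filter fun x : Fin (6 + 6) → Bool => Odd (u' x)) = V.image (bxor xP))
    (hS' : (univ.filter fun x : Fin (6 + 6) → Bool => ¬ Odd (u' x)) = V.image (bxor x'))
    (hoff : ∀ y, ¬ Odd (u' y) → u' y = 2 * sZ (f y))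
    (hcardV : #V = 2 ^ 11) (hPcard : #(univ.filter fun x : Fin (6 + 6) → Bool => Odd (u' x)) = 2048)
    (D : (Fin (6 + 6) → Bool) → Bool) (hD : IsDegLeFun 2 D)
    (hvals : ∀ x, Odd (u' x) → u' x - 2 * sZ (f x) = sZ (D x) ∨ u' x - 2 * sZ (f x) = -3 * sZ (D x))
    (hT : #(univ.filter fun x : Fin (6 + 6) → Bool => Odd (u' x) ∧ u' x - 2 * sZ (f x) = -3 * sZ (D x)) = 128)
    {a₀ a₁ a₂ a₃ : Fin (6 + 6) → Bool} (ha₀ : a₀ ∈ V) (ha₁ : a₁ ∈ V) (ha₂ : a₂ ∈ V) (ha₃ : a₃ ∈ V)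
    (hPf : ((((D zeroVec ^^ D a₁ ^^ D a₀ ^^ D (bxor a₁ a₀)) && (D zeroVec ^^ D a₃ ^^ D a₂ ^^ D (bxor a₃ a₂))) ^^ ((D zeroVec ^^ D a₂ ^^ D a₀ ^^ D (bxor a₂ a₀)) && (D zeroVec ^^ D a₃ ^^ D a₁ ^^ D (bxor a₃ a₁))) ^^ ((D zeroVec ^^ D a₃ ^^ D a₀ ^^ D (bxor a₃ a₀)) && (D zeroVec ^^ D a₂ ^^ D a₁ ^^ D (bxor a₂ a₁))))) = true)
    (t₀ : Fin (6 + 6) → Bool) (ht₀ : Odd (u' t₀) ∧ u' t₀ - 2 * sZ (f t₀) = -3 * sZ (D t₀)) :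
    #(V.filter fun r => ∀ v ∈ V, (D zeroVec ^^ D r ^^ D v ^^ D (bxor r v)) = false) = 128 ∧
      (univ.filter fun x : Fin (6 + 6) → Bool => Odd (u' x) ∧ u' x - 2 * sZ (f x) = -3 * sZ (D x)) =
        (V.filter fun r => ∀ v ∈ V, (D zeroVec ^^ D r ^^ D v ^^ D (bxor r v)) = false).image (bxor t₀) := by
  classical
  set R := (V.filter fun r => ∀ v ∈ V, (D zeroVec ^^ D r ^^ D v ^^ D (bxor r v)) = false) with hR
  have hsub : (univ.filter fun x : Fin (6 + 6) → Bool => Odd (u' x) ∧ u' x - 2 * sZ (f x) = -3 * sZ (D x)) ⊆ R.image (bxor t₀) := by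
    intro t ht
    rw [mem_filter] at ht
    have hr := r1_diff_radical f g hf hg u' hu' V xP x' h0 hadd hS hS' hoff hPcard D hD hvals hT ha₀ ha₁ ha₂ ha₃ hPf t₀ t ht₀ ht.2
    exact mem_image.2 ⟨bxor t₀ t, hr, bxor_bxor_cancel_left t₀ t⟩
  have hinj : Function.Injective (bxor t₀) := fun x y h => by
    have h' := congrArg (bxor t₀) h
    rwa [bxor_bxor_cancel_left, bxor_bxor_cancel_left] at h'
  have hcardim : #(R.image (bxor t₀)) = #R := card_image_of_injective _ hinj
  have hRle : 16 * #R ≤ #V := r1_R_bound D hD V h0 hadd ha₀ ha₁ ha₂ ha₃ hPf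
  rw [hcardV] at hRle
  have h1 : 128 ≤ #R := by
    have h := card_le_card hsub
    rw [hcardim, hT] at h
    exact h
  have hReq : #R = 128 := by
    norm_num at hRle
    omega
  exact ⟨hReq, eq_of_subset_of_card_le hsub (by rw [hcardim, hReq, hT])⟩

end Summit.QuantumAdvantage.QuantumAdvantage.Theorems.CubicForrelation.NearExactIsExact

end
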